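import Literature.NumberTheory.ModularSymbols.FullLevelHomologyCuspidalClass
import Literature.NumberTheory.ModularSymbols.FullLevelHomologyComplexConj
import Literature.Algebra.Homology.GroupHomologyPermutationModuleProjector
import HarnessLib

/-!
# Period classes over `k` (`H(N; k) ↠ k ⊗ Λ_f`) and the spread lattice `Λ_Q(f) ⊆ Fun(GL₂(ℤ/p), k ⊗ Λ_f)` of the
# full-level carrier — the K-line's `GL₂(𝔽_p)`-lattice, defined without Hecke operators

Topic `Literature/NumberTheory/ModularSymbols`; namespaces `Literature.NumberTheory.ModularSymbols` and `….FullLevel`; sequel of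
`FullLevelHomologyCuspidalClass` (`cuspidalClassMap`, `torusInvariantsToCuspidal`), `FullLevelHomologyComplexConj`, and the generic
`Algebra/Homology/GroupHomologyPermutationModuleProjector` (`spread`).  Definitions with bodies + proved theorems; no named fact,
no `sorry`, no instance, no notation.

* `periodMapLattice N f : Λ = H₁(X₀(N), ℤ) →ₗ[ℤ] Λ_f` (the tree's `periodMap f` with values in `periodLattice f`, onto) and its base
  change **`periodClassK N R f : H(N; R) →ₗ[R] R ⊗_ℤ Λ_f`** (onto; `periodClassK_symbol`: `{∞,γ∞} ⊗ 1 ↦ 1 ⊗ {∞,γ∞}_f`).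
* **`FullLevel.torusPeriodClass k p M hpM f : H₁(Γ₀(M), k[GL₂(ℤ/p)])^{T̃} →ₗ[k] k ⊗ Λ_f`** (`f` of level `p²M`; the up/down
  dictionary followed by the periods of `f`; onto) and the **spread period map**
  `spreadPeriod k p M hpM f : H1carrier →ₗ[k] Fun(GL₂(ℤ/p), k ⊗ Λ_f)`, `z ↦ (g ↦ periods of f along e_{T̃}(g·z))`.
* **`spreadLattice k p M hpM f = Λ_Q(f) := range (spreadPeriod …)`** — a `k`-submodule of `Fun(GL₂(ℤ/p), k ⊗ Λ_f)` stable under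
  right translation of functions (`spreadLattice_translate_mem`, from `PermutationCoeff.spread_H1RightRep`), whose evaluation at
  `g = 1` maps onto `k ⊗ Λ_f` (`eval_one_spreadLattice_surjective`).
  For `k = ℤ_p` and `f = f_W` this is the lattice `Λ_Q` of the composed K-line of route BSD/TeichmullerTwistDescent (crux
  `TwistedPeriodLatticeSaturation`, memo KLINE-COMPOSED §2 / CARRIER-gen1 §4): the object about which the automorphic-type input
  (I1) «`Λ_Q ⊗ ℚ_p ≅ Ind(ω̃ᵇ ⊗ ω̃⁻ᵇ)²`» is a statement; the periods of `f` cut out the `f`-part, so no Hecke operator on the carrier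
  is needed to DEFINE it.  Nothing about any elliptic curve is asserted; no fact about `Λ_Q` beyond the above is claimed.

## References
* J. E. Cremona, *Algorithms for modular elliptic curves* (1997), §2.10 (the period lattice `Λ_f` as the image of `H₁(X₀(N), ℤ)`). [CremonaAlgorithms1997]
* A. Ash, G. Stevens, Duke Math. J. 53 (1986), §1 (1.2)–(1.3). [AshStevens1986]
* K. S. Brown, *Cohomology of Groups* (1982), Ch. III §5 (co-induction). [Brown1982]
-/

noncomputable section

namespace Literature.NumberTheory.ModularSymbols

open scoped MatrixGroups TensorProduct
open CategoryTheory CongruenceSubgroup groupHomology Finsupp Matrix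
open Literature.Algebra.Homology
open Literature.NumberTheory.EllipticCurves.ModularForms

section PeriodClassK

variable (N : ℕ) [NeZero N] (R : Type) [CommRing R]

/-- The period map of `f` with values in its period lattice `Λ_f` (as a `ℤ`-module): `Λ = H₁(X₀(N), ℤ) → Λ_f`,
`x ↦ ∫_x 2πi f dz`. [cite: CremonaAlgorithms1997, §2.10] -/
def periodMapLattice (f : CuspForm (Gamma0 N) 2) : periodHomologyHecke N →ₗ[ℤ] (periodLattice f).toIntSubmodule :=
  LinearMap.codRestrict _ (periodMap N f) (fun x =>
    (mem_periodLattice_iff_exists_periodMap N f _).2 ⟨x, rfl⟩)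

/-- `periodMapLattice` composed with the inclusion is `periodMap`. [cite: CremonaAlgorithms1997, §2.10] -/
theorem coe_periodMapLattice (f : CuspForm (Gamma0 N) 2) (x : periodHomologyHecke N) :
    (periodMapLattice N f x : ℂ) = periodMap N f x := rfl

/-- `Λ → Λ_f` is onto. [cite: CremonaAlgorithms1997, §2.10] -/
theorem periodMapLattice_surjective (f : CuspForm (Gamma0 N) 2) : Function.Surjective (periodMapLattice N f) := by
  intro z
  obtain ⟨x, hx⟩ := (mem_periodLattice_iff_exists_periodMap N f z.1).1 z.2
  exact ⟨x, Subtype.ext hx⟩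

/-- **The period class map over `R`**: `H(N; R) = R ⊗ H₁(X₀(N), ℤ) → R ⊗_ℤ Λ_f`, the base change of the period map
onto `Λ_f` (for `R = ℤ_p`: `H₁(X₀(N), ℤ_p) ↠ Λ_f ⊗ ℤ_p`). [cite: CremonaAlgorithms1997, §2.10] -/
def periodClassK (f : CuspForm (Gamma0 N) 2) :
    CuspidalHomologyHeckeModule N R →ₗ[R] R ⊗[ℤ] (periodLattice f).toIntSubmodule :=
  (periodMapLattice N f).baseChange R

/-- `periodClassK (r ⊗ x) = r ⊗ ∫_x f`. [cite: CremonaAlgorithms1997, §2.10] -/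
theorem periodClassK_tmul (f : CuspForm (Gamma0 N) 2) (r : R) (x : periodHomologyHecke N) :
    periodClassK N R f (r ⊗ₜ[ℤ] x) = r ⊗ₜ[ℤ] periodMapLattice N f x :=
  LinearMap.baseChange_tmul _ _ _

/-- `periodClassK ({∞, γ∞} ⊗ 1) = 1 ⊗ {∞, γ∞}_f`. [cite: CremonaAlgorithms1997, §2.10] -/
theorem periodClassK_symbol (f : CuspForm (Gamma0 N) 2) (γ : Gamma0 N) :
    periodClassK N R f (symbol N R γ) = (1 : R) ⊗ₜ[ℤ] periodMapLattice N f (symbolInt N γ) := by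
  rw [symbol_def, periodClassK_tmul]

/-- The period class map over `R` is onto `R ⊗ Λ_f`. [cite: CremonaAlgorithms1997, §2.10] -/
theorem periodClassK_surjective (f : CuspForm (Gamma0 N) 2) : Function.Surjective (periodClassK N R f) :=
  LinearMap.baseChange_surjective R (periodMapLattice_surjective N f)

end PeriodClassK

namespace FullLevel

variable (k : Type) [CommRing k] (p M : ℕ) [Fact p.Prime] [NeZero M]
variable (hpM : Nat.Coprime p M) [Fintype (diagTorus (ZMod p))] [Invertible (Fintype.card (diagTorus (ZMod p)) : k)]

/-- **The torus-averaged period class map of `f` on the full-level carrier**: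
`H₁(Γ₀(M), k[GL₂(ℤ/p)])^{T̃} ≃ H₁(Γ₀(p²M), k) ↠ H(p²M; k) ↠ k ⊗ Λ_f` for a cusp form `f` of level `p²M`.
[cite: AshStevens1986, §1 (1.3); CremonaAlgorithms1997, §2.10] -/
def torusPeriodClass (f : CuspForm (Gamma0 (p ^ 2 * M)) 2) :
    PermutationCoeff.H1Invariants k (redGL p M) (diagTorus (ZMod p)) →ₗ[k] k ⊗[ℤ] (periodLattice f).toIntSubmodule :=
  (@periodClassK (p ^ 2 * M) (neZero_sq_mul p M) k _ f).comp (torusInvariantsToCuspidal k p M hpM)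

/-- The torus-averaged period class map is onto `k ⊗ Λ_f`. [cite: CremonaAlgorithms1997, §2.10] -/
theorem torusPeriodClass_surjective (f : CuspForm (Gamma0 (p ^ 2 * M)) 2) :
    Function.Surjective (torusPeriodClass k p M hpM f) :=
  (@periodClassK_surjective (p ^ 2 * M) (neZero_sq_mul p M) k _ f).comp
    (torusInvariantsToCuspidal_surjective k p M hpM)

/-- **The spread period map** `Π_f : H₁(Γ₀(M), k[GL₂(ℤ/p)]) → Fun(GL₂(ℤ/p), k ⊗ Λ_f)`,
`z ↦ (g ↦ periods of f along e_{T̃}(g·z))` (`PermutationCoeff.spread`).  It is `GL₂(ℤ/p)`-equivariant for right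
translation of functions (`PermutationCoeff.spread_H1RightRep`). [cite: AshStevens1986, §1 (1.2)–(1.3)] -/
def spreadPeriod (f : CuspForm (Gamma0 (p ^ 2 * M)) 2) :
    H1carrier k p M →ₗ[k] (GL (Fin 2) (ZMod p) → k ⊗[ℤ] (periodLattice f).toIntSubmodule) :=
  PermutationCoeff.spread (redGL p M) (diagTorus (ZMod p)) (torusPeriodClass k p M hpM f)

/-- **The lattice `Λ_Q(f)`** of the K-line: the image of the full-level carrier under the spread period map of `f`
— a `k`-submodule of `Fun(GL₂(ℤ/p), k ⊗ Λ_f)` stable under right translation (`spreadLattice_smul_mem`), defined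
WITHOUT Hecke operators (periods of `f` cut out the `f`-part).  For `k = ℤ_p` and `f = f_W` this is the object about
which the automorphic-type input (I1) of the K-line (`Λ_Q ⊗ ℚ_p ≅ Ind(ω̃ᵇ ⊗ ω̃⁻ᵇ)²`) is to be stated.
[cite: AshStevens1986, §1 (1.3)] -/
def spreadLattice (f : CuspForm (Gamma0 (p ^ 2 * M)) 2) :
    Submodule k (GL (Fin 2) (ZMod p) → k ⊗[ℤ] (periodLattice f).toIntSubmodule) :=
  LinearMap.range (spreadPeriod k p M hpM f)

/-- Right translation of functions `(R_{g₀} F)(g) = F(g g₀)`. [cite: Brown1982, Ch. III §5] -/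
def funTranslate {V : Type} (g₀ : GL (Fin 2) (ZMod p)) (F : GL (Fin 2) (ZMod p) → V) : GL (Fin 2) (ZMod p) → V :=
  fun g => F (g * g₀)

/-- **`Λ_Q(f)` is `GL₂(ℤ/p)`-stable**: `F ∈ Λ_Q ⇒ R_{g₀}F ∈ Λ_Q` (equivariance of the spread).
[cite: AshStevens1986, §1 (1.2)] -/
theorem spreadLattice_translate_mem (f : CuspForm (Gamma0 (p ^ 2 * M)) 2) (g₀ : GL (Fin 2) (ZMod p))
    {F : GL (Fin 2) (ZMod p) → k ⊗[ℤ] (periodLattice f).toIntSubmodule} (hF : F ∈ spreadLattice k p M hpM f) :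
    funTranslate p g₀ F ∈ spreadLattice k p M hpM f := by
  obtain ⟨z, rfl⟩ := hF
  refine ⟨H1carrierRep k p M g₀ z, ?_⟩
  rw [spreadPeriod, H1carrierRep, PermutationCoeff.spread_H1RightRep]
  rfl

/-- The value of the spread at `g = 1` on a `T̃`-invariant class is its torus period class.
[cite: AshStevens1986, §1 (1.3)] -/
theorem spreadPeriod_apply_one (f : CuspForm (Gamma0 (p ^ 2 * M)) 2)
    (z : PermutationCoeff.H1Invariants k (redGL p M) (diagTorus (ZMod p))) :
    spreadPeriod k p M hpM f (z : H1carrier k p M) 1 = torusPeriodClass k p M hpM f z :=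
  PermutationCoeff.spread_apply_one _ _ _ z

/-- Evaluation of `Λ_Q(f)` at `g = 1` maps onto `k ⊗ Λ_f` (so `Λ_Q(f) ≠ 0` as soon as `Λ_f ≠ 0`).
[cite: CremonaAlgorithms1997, §2.10] -/
theorem eval_one_spreadLattice_surjective (f : CuspForm (Gamma0 (p ^ 2 * M)) 2)
    (w : k ⊗[ℤ] (periodLattice f).toIntSubmodule) :
    ∃ F ∈ spreadLattice k p M hpM f, F 1 = w := by
  obtain ⟨z, rfl⟩ := torusPeriodClass_surjective k p M hpM f w
  exact ⟨_, ⟨(z : H1carrier k p M), rfl⟩, spreadPeriod_apply_one k p M hpM f z⟩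

end FullLevel

end Literature.NumberTheory.ModularSymbols
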